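import Summits.BirchSwinnertonDyer.BirchSwinnertonDyer.Theorems.ErratumRoadFiveEulerHalfNotRamPAnchorDegree
import HarnessLib

/-!
# Route `ErratumRoadFive` (K2, `p ≥ 5`), crux `EulerHalfNotRamNoInertSetAtFive` (item stmt-BirchSwinnertonDyer-19715), line `birth`:
# the ONE-ANCHOR DEGREE TELESCOPE — (DEG) `ord_ℓ δ(∅) = ord_ℓ δ(S) + Σ_{q∈S} ord_ℓ c_q` for every even level `S` containing ONE anchor prime

Width seat `bsd-line-er5-p1-w2` g2 (cell bsd-stepL), `--supports stmt-BirchSwinnertonDyer-19715 --as helper`. Theorems only (no definition, no named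
fact, no `sorry`), over the tree's abstract Ribet–Takahashi ∕ Pasten degree package `Summit.BirchSwinnertonDyer.Rank1Residual.X11b.RTDegree` (section
variables (P613) both expressions, positivity, (Pij), (P68)@ℓ, (PEis)@ℓ — exactly those of the LEAD's `EulerHalfPAnchor.PAnchor`, §1 of the `p`-anchor).

WHAT. The `p`-anchor (idea-crit-14 V29 ∕ bsd-idea-9 g4; LEAD er5-p1 g1 p629458 `PAnchor.padicValNat_delta_empty_eq_of_self_mem`) runs the (DEG) telescope on
every even `S ∋ ℓ` because the cokernel term at `ℓ` itself is an `ℓ`-unit ((P618): `κ_S(ℓ) ∣ ℓ − 1`) and Pasten's switching lemma (L6.15, tree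
`RTDegree.padicValNat_coker_eq_of_pair`) transports that to every `κ_S(q)`, `q ∈ S`. The same two lines work for ANY prime `a ∈ S` whose cokernel term is an
`ℓ`-unit at every even level containing it — an **anchor**:
* `padicValNat_coker_eq_zero_of_anchor_mem` — an anchor `a ∈ D` kills EVERY cokernel term `κ_D(q)`, `q ∈ D` (switching against `a`);
* `padicValNat_delta_empty_eq_of_anchor_mem` — **(DEG) for every even `S ∋ a`** (the `a`-last telescope; `PAnchor`'s proof with `ℓ ↦ a` in the combinatorics);
* anchor SUPPLIERS: `anchor_of_self` (`a = ℓ`, (P618): the `p`-anchor), `anchor_of_not_dvd_sub_one` (`a` odd with `ℓ ∤ a − 1`, (P618) — ONE «good pairing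
  prime» instead of a Papikian–Rabinoff HALF), `anchor_of_two` (`a = 2`, the full (P618) clause `κ_D(2) ∣ 2`, `ℓ` odd), `anchor_of_witness` (`ℓ ∤ c_a(E)`, a
  (ram)-type witness INSIDE the level, via `RTDegree.padicValNat_coker_le`);
* packaged corollaries `padicValNat_delta_empty_eq_of_goodPrime_mem` ∕ `…_of_two_mem` ∕ `…_of_witness_mem` ∕ `…_of_oneAnchorDatum` (the `p`-anchor itself
  is the instance `a = ℓ`: the LEAD's `PAnchor.padicValNat_delta_empty_eq_of_self_mem`, not restated).
CONSEQUENCE (generality, for the planners; no census number of 19715 moves): on the SPLIT frames (`ℓ ∉ S`) and on the `p`-good corner (19065-type residuals,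
where no `p ∈ S` exists) the degree datum «(W) witness ∨ (P) half `R ⊆ S`, `#S = 2·#R`, `∀ q ∈ R, q ≠ 2 → ℓ ∤ q − 1`» of the landed split-set ∕ inert roads
weakens to «ONE `q ∈ S` with `q = 2 ∨ ℓ ∤ q − 1 ∨ ℓ ∤ c_q`»; a consumer swaps its `have hdeg := …_of_oddPairing …` for `…_of_goodPrime_mem …` with no other change.

HONEST FRAMING: arithmetic bookkeeping over typed inputs (the package's clauses are hypotheses, fed in the tree from the route item `PastenComponentOrdersInput`
by `ribetTakahashiPackageCoker[Two]_of_componentOrders`); nothing is claimed about any curve; item 19715 is NOT closed (its residual slot already left the line by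
the `p`-anchor); BSD is proved for no curve; no summit statement is touched.
[cite: PastenShimura2024, Prop. 6.13, Lemma 6.15, Lemma 6.18] [cite: PapikianRabinoff2016, Cor. 3.5] [cite: RibetTakahashi1997, Thm. 1]
-/

set_option autoImplicit false
set_option linter.dupNamespace false

noncomputable section

open scoped Classical

open Summit.BirchSwinnertonDyer.Rank1Residual.X11b

namespace Summit.BirchSwinnertonDyer.BirchSwinnertonDyer.Theorems.EulerHalfAnchorDegree

variable {ℓ : ℕ} [Fact ℓ.Prime]
variable {Mult : Finset ℕ} {δ : Finset ℕ → ℕ} {cA ι κ : Finset ℕ → ℕ → ℕ} {c : ℕ → ℕ}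
  -- (P613) Pasten Prop. 6.13 (both expressions)
  (h613 : ∀ ⦃d : Finset ℕ⦄, d ⊆ Mult → Even d.card → ∀ ⦃q r : ℕ⦄, q ∈ Mult → r ∈ Mult →
    q ∉ d → r ∉ d → q ≠ r →
    δ d * ι d q ^ 2 * κ (insert q (insert r d)) r ^ 2 =
      δ (insert q (insert r d)) * cA d q * cA (insert q (insert r d)) r)
  (hδ : ∀ D, 0 < δ D) (hcA : ∀ D q, 0 < cA D q)
  (hij : ∀ ⦃D : Finset ℕ⦄, D ⊆ Mult → ∀ ⦃q : ℕ⦄, q ∈ Mult → ι D q * κ D q = cA D q)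
  (hvA : ∀ ⦃D : Finset ℕ⦄, D ⊆ Mult → ∀ ⦃q : ℕ⦄, q ∈ Mult →
    padicValNat ℓ (cA D q) = padicValNat ℓ (c q))
  (hι : ∀ ⦃d : Finset ℕ⦄, d ⊆ Mult → ∀ ⦃q : ℕ⦄, q ∈ Mult → q ∉ d → padicValNat ℓ (ι d q) = 0)

/-! ### §1 An anchor kills every cokernel term of its level; the anchored telescope -/

section Telescope

include h613 hδ hcA hij hvA hι

/-- **An anchor `a ∈ D` makes EVERY cokernel term of the even level `D` an `ℓ`-adic unit** (Pasten L6.15 switching against `a`): if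
`ord_ℓ κ_{D'}(a) = 0` at every even level `D' ∋ a`, then `ord_ℓ κ_D(q) = 0` for all `q ∈ D`. (`PAnchor.padicValNat_coker_eq_zero_of_self_mem` with
`ℓ ↦ a`.) [cite: PastenShimura2024, Prop. 6.13, Lemma 6.15] -/
theorem padicValNat_coker_eq_zero_of_anchor_mem {a : ℕ}
    (ha : ∀ ⦃D : Finset ℕ⦄, D ⊆ Mult → Even D.card → a ∈ D → padicValNat ℓ (κ D a) = 0)
    {D : Finset ℕ} (hD : D ⊆ Mult) (hDe : Even D.card) (haD : a ∈ D)
    {q : ℕ} (hq : q ∈ D) : padicValNat ℓ (κ D q) = 0 := by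
  have hself := ha hD hDe haD
  by_cases hqa : q = a
  · subst hqa; exact hself
  · set d := (D.erase q).erase a with hd_def
    have hdD : d ⊆ D := (Finset.erase_subset _ _).trans (Finset.erase_subset _ _)
    have hd : d ⊆ Mult := hdD.trans hD
    have hqd : q ∉ d := fun h ↦ (Finset.notMem_erase q D) ((Finset.erase_subset a _) h)
    have had : a ∉ d := Finset.notMem_erase a _
    have ha' : a ∈ D.erase q := Finset.mem_erase.mpr ⟨Ne.symm hqa, haD⟩
    have hDeq : insert q (insert a d) = D := by
      rw [hd_def, Finset.insert_erase ha', Finset.insert_erase hq]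
    have hcard : D.card = d.card + 2 := by
      have h1 := Finset.card_erase_of_mem hq
      have h2 := Finset.card_erase_of_mem ha'
      have h3 : 0 < D.card := Finset.card_pos.mpr ⟨q, hq⟩
      have h4 : 0 < (D.erase q).card := Finset.card_pos.mpr ⟨a, ha'⟩
      rw [hd_def]; omega
    have hde : Even d.card := by
      rw [hcard] at hDe
      exact (Nat.even_add.mp hDe).mpr (by decide)
    have h := RTDegree.padicValNat_coker_eq_of_pair h613 hδ hcA hij hvA hι hd hde (hD hq) (hD haD) hqd had hqa
    rw [hDeq] at h
    omega

/-- **(DEG) for every even `S` containing an anchor `a`, witness-free and half-free:** `ord_ℓ δ(∅) = ord_ℓ δ(S) + Σ_{q∈S} ord_ℓ c_q(E)`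
(the `a`-last telescope over `RTDegree.padicValNat_delta_empty_step`; `PAnchor.padicValNat_delta_empty_eq_of_self_mem` with `ℓ ↦ a`).
[cite: PastenShimura2024, Prop. 6.13, §6.6] [cite: RibetTakahashi1997, Thm. 1] -/
theorem padicValNat_delta_empty_eq_of_anchor_mem {a : ℕ}
    (ha : ∀ ⦃D : Finset ℕ⦄, D ⊆ Mult → Even D.card → a ∈ D → padicValNat ℓ (κ D a) = 0) :
    ∀ (n : ℕ) (S : Finset ℕ), S ⊆ Mult → S.card = 2 * n → (S = ∅ ∨ a ∈ S) →
      padicValNat ℓ (δ ∅) = padicValNat ℓ (δ S) + ∑ x ∈ S, padicValNat ℓ (c x) := by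
  intro n
  induction n with
  | zero =>
    intro S _ hS _
    rw [Finset.card_eq_zero.mp (by omega : S.card = 0)]
    simp
  | succ n IH =>
    intro S hS hcard ha₀
    have haS : a ∈ S := by
      rcases ha₀ with h | h
      · subst h; simp at hcard
      · exact h
    have hSe : Even S.card := ⟨n + 1, by omega⟩
    have hκS : ∀ x ∈ S, padicValNat ℓ (κ S x) = 0 := fun x hx ↦
      padicValNat_coker_eq_zero_of_anchor_mem h613 hδ hcA hij hvA hι ha hS hSe haS hx
    have hne : (S.erase a).Nonempty := by
      apply Finset.card_pos.mp; rw [Finset.card_erase_of_mem haS]; omega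
    obtain ⟨r, hr⟩ := hne
    obtain ⟨hra, hrS⟩ := Finset.mem_erase.mp hr
    have hq : ∃ q ∈ S, q ≠ r ∧ (n = 0 ∨ q ≠ a) := by
      by_cases hn : n = 0
      · exact ⟨a, haS, Ne.symm hra, Or.inl hn⟩
      · have hne' : ((S.erase a).erase r).Nonempty := by
          apply Finset.card_pos.mp
          rw [Finset.card_erase_of_mem hr, Finset.card_erase_of_mem haS]; omega
        obtain ⟨q, hq⟩ := hne'
        obtain ⟨hqr, hq'⟩ := Finset.mem_erase.mp hq
        obtain ⟨hqa, hqS⟩ := Finset.mem_erase.mp hq'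
        exact ⟨q, hqS, hqr, Or.inr hqa⟩
    obtain ⟨q, hqS, hqr, hqn⟩ := hq
    set d := (S.erase q).erase r with hd_def
    have hrq' : r ∈ S.erase q := Finset.mem_erase.mpr ⟨hqr.symm, hrS⟩
    have hSeq : insert q (insert r d) = S := by
      rw [hd_def, Finset.insert_erase hrq', Finset.insert_erase hqS]
    have hdS : d ⊆ S := (Finset.erase_subset _ _).trans (Finset.erase_subset _ _)
    have hd : d ⊆ Mult := hdS.trans hS
    have hqd : q ∉ d := fun h ↦ (Finset.notMem_erase q S) ((Finset.erase_subset r _) h)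
    have hrd : r ∉ d := Finset.notMem_erase r _
    have hdcard : d.card = 2 * n := by
      have h1 := Finset.card_erase_of_mem hqS
      have h2 := Finset.card_erase_of_mem hrq'
      rw [hd_def]; omega
    have hde : Even d.card := ⟨n, by omega⟩
    have hda : d = ∅ ∨ a ∈ d := by
      rcases hqn with hn | hqa
      · left; subst hn; exact Finset.card_eq_zero.mp (by omega)
      · right
        exact Finset.mem_erase.mpr ⟨Ne.symm hra, Finset.mem_erase.mpr ⟨Ne.symm hqa, haS⟩⟩
    have IH' := IH d hd hdcard hda
    have hκ : padicValNat ℓ (κ (insert q (insert r d)) r) = 0 := by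
      rw [hSeq]; exact hκS r hrS
    have := RTDegree.padicValNat_delta_empty_step h613 hδ hcA hij hvA hι hd hde (hS hqS) (hS hrS) hqd hrd hqr
      hκ IH'
    rwa [hSeq] at this

end Telescope

/-! ### §2 Anchor suppliers: the residual prime itself, one good pairing prime, the prime `2`, a (ram)-type witness -/

section Suppliers

/-- **The residual prime is an anchor** (the `p`-ANCHOR, (P618) at `q = ℓ`: `κ_D(ℓ) ∣ ℓ − 1`). (= `PAnchor.padicValNat_coker_self_eq_zero`.)
[cite: PastenShimura2024, Lemma 6.18] -/
theorem anchor_of_self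
    (h618 : ∀ ⦃D : Finset ℕ⦄, D ⊆ Mult → Even D.card → ∀ ⦃q : ℕ⦄, q ∈ D → q ≠ 2 → κ D q ∣ q - 1) (hℓ2 : ℓ ≠ 2) :
    ∀ ⦃D : Finset ℕ⦄, D ⊆ Mult → Even D.card → ℓ ∈ D → padicValNat ℓ (κ D ℓ) = 0 :=
  fun _ hD hDe hℓD ↦ EulerHalfPAnchor.PAnchor.padicValNat_coker_self_eq_zero h618 hℓ2 hD hDe hℓD

omit [Fact ℓ.Prime] in
/-- **ONE good pairing prime is an anchor**: an odd `a` with `ℓ ∤ a − 1` has `ord_ℓ κ_D(a) = 0` at every even level `D ∋ a` ((P618): `κ_D(a) ∣ a − 1`).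
[cite: PastenShimura2024, Lemma 6.18] [cite: PapikianRabinoff2016, Cor. 3.5] -/
theorem anchor_of_not_dvd_sub_one
    (h618 : ∀ ⦃D : Finset ℕ⦄, D ⊆ Mult → Even D.card → ∀ ⦃q : ℕ⦄, q ∈ D → q ≠ 2 → κ D q ∣ q - 1)
    {a : ℕ} (ha2 : a ≠ 2) (hna : ¬ ℓ ∣ a - 1) :
    ∀ ⦃D : Finset ℕ⦄, D ⊆ Mult → Even D.card → a ∈ D → padicValNat ℓ (κ D a) = 0 :=
  fun _ hD hDe haD ↦ padicValNat.eq_zero_of_not_dvd fun h ↦ hna (h.trans (h618 hD hDe haD ha2))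

/-- **The prime `2` is an anchor** at odd `ℓ` (the full (P618) clause `κ_D(2) ∣ 2`). [cite: PastenShimura2024, Lemma 6.18] -/
theorem anchor_of_two
    (h618₂ : ∀ ⦃D : Finset ℕ⦄, D ⊆ Mult → Even D.card → ∀ ⦃q : ℕ⦄, q ∈ D → q = 2 → κ D q ∣ 2) (hℓ2 : ℓ ≠ 2) :
    ∀ ⦃D : Finset ℕ⦄, D ⊆ Mult → Even D.card → 2 ∈ D → padicValNat ℓ (κ D 2) = 0 := by
  intro D hD hDe h2D
  have hℓp : ℓ.Prime := Fact.out
  refine padicValNat.eq_zero_of_not_dvd fun h ↦ ?_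
  have h1 : ℓ ∣ 2 := h.trans (h618₂ hD hDe h2D rfl)
  exact hℓ2 ((Nat.prime_dvd_prime_iff_eq hℓp Nat.prime_two).mp h1)

include hcA hij hvA in
/-- **A witness INSIDE the level is an anchor**: `a ∈ Mult` with `ℓ ∤ c_a(E)` has `ord_ℓ κ_D(a) = 0` at every level (`κ ∣ c(A)`, (P68)@ℓ; the tree's
`RTDegree.padicValNat_coker_le`). [cite: PastenShimura2024, §6.6 and Lemma 6.15] -/
theorem anchor_of_witness {a : ℕ} (haM : a ∈ Mult) (hw : padicValNat ℓ (c a) = 0) :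
    ∀ ⦃D : Finset ℕ⦄, D ⊆ Mult → Even D.card → a ∈ D → padicValNat ℓ (κ D a) = 0 := by
  intro D hD _ _
  have h := RTDegree.padicValNat_coker_le hcA hij hvA hD haM
  omega

end Suppliers

/-! ### §3 Packaged: (DEG) for every even level containing one good prime ∕ the prime `2` ∕ a witness ∕ the residual prime -/

section Packaged

include h613 hδ hcA hij hvA hι

/-- **(DEG) for every even `S` containing ONE odd prime `a` with `ℓ ∤ a − 1`** — the Papikian–Rabinoff HALF of the landed split-set ∕ inert roads
(`#S = 2·#R`, every `q ∈ R` good) is replaced by a single good prime. [cite: PastenShimura2024, Prop. 6.13, Lemma 6.15, Lemma 6.18] -/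
theorem padicValNat_delta_empty_eq_of_goodPrime_mem
    (h618 : ∀ ⦃D : Finset ℕ⦄, D ⊆ Mult → Even D.card → ∀ ⦃q : ℕ⦄, q ∈ D → q ≠ 2 → κ D q ∣ q - 1)
    {a : ℕ} (ha2 : a ≠ 2) (hna : ¬ ℓ ∣ a - 1) :
    ∀ (n : ℕ) (S : Finset ℕ), S ⊆ Mult → S.card = 2 * n → (S = ∅ ∨ a ∈ S) →
      padicValNat ℓ (δ ∅) = padicValNat ℓ (δ S) + ∑ x ∈ S, padicValNat ℓ (c x) :=
  padicValNat_delta_empty_eq_of_anchor_mem h613 hδ hcA hij hvA hι (anchor_of_not_dvd_sub_one h618 ha2 hna)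

/-- **(DEG) for every even `S ∋ 2`** at odd `ℓ` (the prime `2` is always a good pairing prime). [cite: PastenShimura2024, Lemma 6.18] -/
theorem padicValNat_delta_empty_eq_of_two_mem
    (h618₂ : ∀ ⦃D : Finset ℕ⦄, D ⊆ Mult → Even D.card → ∀ ⦃q : ℕ⦄, q ∈ D → q = 2 → κ D q ∣ 2) (hℓ2 : ℓ ≠ 2) :
    ∀ (n : ℕ) (S : Finset ℕ), S ⊆ Mult → S.card = 2 * n → (S = ∅ ∨ 2 ∈ S) →
      padicValNat ℓ (δ ∅) = padicValNat ℓ (δ S) + ∑ x ∈ S, padicValNat ℓ (c x) :=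
  padicValNat_delta_empty_eq_of_anchor_mem h613 hδ hcA hij hvA hι (anchor_of_two h618₂ hℓ2)

/-- **(DEG) for every even `S` containing a witness `a` with `ℓ ∤ c_a(E)`** (the (W) road's witness, now required only to lie in `S`).
[cite: PastenShimura2024, Lemma 6.15] -/
theorem padicValNat_delta_empty_eq_of_witness_mem {a : ℕ} (haM : a ∈ Mult) (hw : padicValNat ℓ (c a) = 0) :
    ∀ (n : ℕ) (S : Finset ℕ), S ⊆ Mult → S.card = 2 * n → (S = ∅ ∨ a ∈ S) →
      padicValNat ℓ (δ ∅) = padicValNat ℓ (δ S) + ∑ x ∈ S, padicValNat ℓ (c x) :=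
  padicValNat_delta_empty_eq_of_anchor_mem h613 hδ hcA hij hvA hι (anchor_of_witness hcA hij hvA haM hw)

/-- **(DEG) from a ONE-ANCHOR DATUM** in the shape a road consumes: an even `S ⊆ Mult` with SOME `a ∈ S` such that `a = ℓ`, or `a = 2`, or
`ℓ ∤ a − 1`, or `ℓ ∤ c_a(E)` (given the full (P618) clause and `ℓ` odd). [cite: PastenShimura2024, Prop. 6.13, Lemma 6.15, Lemma 6.18] -/
theorem padicValNat_delta_empty_eq_of_oneAnchorDatum
    (h618full : ∀ ⦃D : Finset ℕ⦄, D ⊆ Mult → Even D.card → ∀ ⦃q : ℕ⦄, q ∈ D →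
      (q ≠ 2 → κ D q ∣ q - 1) ∧ (q = 2 → κ D q ∣ 2))
    (hℓ2 : ℓ ≠ 2) {S : Finset ℕ} (hS : S ⊆ Mult) (hSe : Even S.card)
    (hanchor : ∃ a ∈ S, a = ℓ ∨ a = 2 ∨ ¬ ℓ ∣ a - 1 ∨ padicValNat ℓ (c a) = 0) :
    padicValNat ℓ (δ ∅) = padicValNat ℓ (δ S) + ∑ x ∈ S, padicValNat ℓ (c x) := by
  have h618 : ∀ ⦃D : Finset ℕ⦄, D ⊆ Mult → Even D.card → ∀ ⦃q : ℕ⦄, q ∈ D → q ≠ 2 → κ D q ∣ q - 1 :=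
    fun D hD hDe q hq hq2 ↦ (h618full hD hDe hq).1 hq2
  have h618₂ : ∀ ⦃D : Finset ℕ⦄, D ⊆ Mult → Even D.card → ∀ ⦃q : ℕ⦄, q ∈ D → q = 2 → κ D q ∣ 2 :=
    fun D hD hDe q hq hq2 ↦ (h618full hD hDe hq).2 hq2
  obtain ⟨n, hn⟩ := hSe
  have hcard : S.card = 2 * n := by omega
  obtain ⟨a, haS, h⟩ := hanchor
  have ha : ∀ ⦃D : Finset ℕ⦄, D ⊆ Mult → Even D.card → a ∈ D → padicValNat ℓ (κ D a) = 0 := by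
    rcases h with rfl | rfl | hna | hw
    · exact anchor_of_self h618 hℓ2
    · exact anchor_of_two h618₂ hℓ2
    · by_cases ha2 : a = 2
      · subst ha2; exact anchor_of_two h618₂ hℓ2
      · exact anchor_of_not_dvd_sub_one h618 ha2 hna
    · exact anchor_of_witness hcA hij hvA (hS haS) hw
  exact padicValNat_delta_empty_eq_of_anchor_mem h613 hδ hcA hij hvA hι ha n S hS hcard (Or.inr haS)

end Packaged

end Summit.BirchSwinnertonDyer.BirchSwinnertonDyer.Theorems.EulerHalfAnchorDegree

end
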